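import Summits.HubbardSuperconductivity.HubbardSuperconductivity.Theorems.AnisotropyChordTransferFibre3FinXCCover

/-!
# Route `AnisotropyChord` / H0 rotor rung: FIN combined (rows `N₁` + C) certificate at `L = 9` — cell facts, part `o`

Kernel facts `xbcCellAny 9 (49/50) 20 la lb (c, bn) = true` (`decide +kernel`, zero data) for 8 λ-cells of the per-`L` cover
(`…FinXCCover.xbcCheck`; cell design: p3 g5 scratch `xbc_design.py`, mirrors `xb_mirror.py`/`xc_mirror.py`); assembled in `…FinXBCNine`.
Prover seat `hubbard-h0-rotor-p3` g5; helper for piece A = stmt-HubbardSuperconductivity-23918 of rung 19089 (`--supports`, helper class).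
WHAT THIS IS NOT: nothing here proves superconductivity in the Hubbard model (rotor TARGET as worded stays FALSE, g15 verdict); kernel facts for the FIN certificate of two hypotheses (rows `N₁`, C) of ONE conditional reduction.  Tree imports only; no sorry, no new axioms.
-/

set_option linter.dupNamespace false

namespace Summit.HubbardSuperconductivity.HubbardSuperconductivity.Theorems.AnisotropyChord.Transfer.Fibre3

namespace FinXB

set_option maxHeartbeats 4000000 in
/-- kernel fact: cell 124 at `L = 9` (certified, c = (9/20 : ℚ), b = 18/20). [folklore] -/
theorem xbc9_124 : xbcCellAny 9 (49/50 : ℚ) 20 14827041816656211 15197717862072617 ((9/20 : ℚ), (18 : ℕ)) = true := by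
  decide +kernel

set_option maxHeartbeats 4000000 in
/-- kernel fact: cell 125 at `L = 9` (certified, c = (9/20 : ℚ), b = 18/20). [folklore] -/
theorem xbc9_125 : xbcCellAny 9 (49/50 : ℚ) 20 15197717862072617 15577660808624431 ((9/20 : ℚ), (18 : ℕ)) = true := by
  decide +kernel

set_option maxHeartbeats 4000000 in
/-- kernel fact: cell 126 at `L = 9` (certified, c = (9/20 : ℚ), b = 18/20). [folklore] -/
theorem xbc9_126 : xbcCellAny 9 (49/50 : ℚ) 20 15577660808624431 15967102328840043 ((9/20 : ℚ), (18 : ℕ)) = true := by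
  decide +kernel

set_option maxHeartbeats 4000000 in
/-- kernel fact: cell 127 at `L = 9` (certified, c = (9/20 : ℚ), b = 18/20). [folklore] -/
theorem xbc9_127 : xbcCellAny 9 (49/50 : ℚ) 20 15967102328840043 16366279887061045 ((9/20 : ℚ), (18 : ℕ)) = true := by
  decide +kernel

set_option maxHeartbeats 4000000 in
/-- kernel fact: cell 128 at `L = 9` (certified, c = (9/20 : ℚ), b = 18/20). [folklore] -/
theorem xbc9_128 : xbcCellAny 9 (49/50 : ℚ) 20 16366279887061045 16775436884237569 ((9/20 : ℚ), (18 : ℕ)) = true := by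
  decide +kernel

set_option maxHeartbeats 4000000 in
/-- kernel fact: cell 129 at `L = 9` (certified, c = (9/20 : ℚ), b = 19/20). [folklore] -/
theorem xbc9_129 : xbcCellAny 9 (49/50 : ℚ) 20 16775436884237569 17194822806343507 ((9/20 : ℚ), (19 : ℕ)) = true := by
  decide +kernel

set_option maxHeartbeats 4000000 in
/-- kernel fact: cell 130 at `L = 9` (certified, c = (9/20 : ℚ), b = 19/20). [folklore] -/
theorem xbc9_130 : xbcCellAny 9 (49/50 : ℚ) 20 17194822806343507 17624693376502095 ((9/20 : ℚ), (19 : ℕ)) = true := by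
  decide +kernel

set_option maxHeartbeats 4000000 in
/-- kernel fact: cell 131 at `L = 9` (certified, c = (9/20 : ℚ), b = 19/20). [folklore] -/
theorem xbc9_131 : xbcCellAny 9 (49/50 : ℚ) 20 17624693376502095 18065310710914649 ((9/20 : ℚ), (19 : ℕ)) = true := by
  decide +kernel

end FinXB

end Summit.HubbardSuperconductivity.HubbardSuperconductivity.Theorems.AnisotropyChord.Transfer.Fibre3
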